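import Summits.QuantumFields.YangMills.Theorems.VirialFluxGapFixHtubePhasePackageFinal
import Summits.QuantumFields.YangMills.Theorems.VirialFluxGapFinalAssemblyPieces
import Summits.QuantumFields.YangMills.Theorems.VirialFluxGapWindowChoice
import Summits.QuantumFields.YangMills.Theorems.VirialFluxGapOrbitConstPoly
import Summits.QuantumFields.YangMills.Theorems.VirialFluxGapOrbitCoeffLog
import Summits.QuantumFields.YangMills.Theorems.VirialFluxGapFixTubeFloorRep
import Summits.QuantumFields.YangMills.Theorems.VirialFluxGapFixTubeDisjoint
import HarnessLib

/-!
# ★★★★ ⟨stmt-QuantumFields-24204⟩ `VirialFluxGap.SharpTwistedLaplace` — final assembly of the DIRECT Laplace road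
Width seat ym-line-sfw-p2-w3 g57 (cell ym-idea-1) assembling the cell's helper chain (w2 g49/g50, w3 g56/g57) into
✓`QuantitativeLaplace.sharpTwistedLaplace_of_fixTubes`: `ι = Bool × Bool` ↪ the four faithful sign classes (`s k₀ = false`,
✓`exists_signClass_embedding_surj`), pivot `k₀(z)`, centre field (✓`exists_twistSign`), anchors (✓`exists_anchor_frame`), base points
`(combFlat W_s, combFlat W_s, λ·C₀)`; tubes `SU(2)·σ_s(closed ball of radius R(L))`, `R(L) = c_R·L⁻⁴¹` (✓`window_choice`); `hTm` ✓`fix_hT`,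
`hdisj` ✓`fixTubes_disjoint`, `htube` ✓`fix_htube_of_phasePackage''`, `hK` ✓`orbitConst_le_poly_pow`, `hΛ` ✓`abs_log_orbitCoeff_le` +
✓`abs_log_sum_le`, `hfloor` ✓`ringDeficit_fix_floor_off_repTubes` with `ρ = R²/(2·10⁵L⁴)`.  One `set_option maxHeartbeats` for the single
assembly theorem (≈ 200 s of elaboration; every step is a direct application of landed lemmas).
HONEST FRAMING: closes the RECORD-label rung ⟨24204⟩ of route VirialFluxGap ONLY (sharp Laplace asymptotics of the twisted sector weight of the
femto-transfer model); ⟨22884⟩ and every other rung stay OPEN; the Yang–Mills mass gap (Clay) is NOT proved; no summit is proved by a line.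

## References
* M. Lüscher, *Nucl. Phys. B* 219 (1983) 233–261, §2. [Luscher1983]
* K. W. Breitung, *Asymptotic Approximations for Probability Integrals*, LNM 1592 (1994), Thm 41 p. 56. [Breitung1994]
* G. E. Bredon, *Introduction to Compact Transformation Groups* (1972), Ch. II §§4–5. [Bredon1972]
-/

set_option autoImplicit false

noncomputable section

open MeasureTheory Set Filter Metric WithLp Module
open scoped ENNReal RealInnerProductSpace Pointwise Quaternion BigOperators
open Literature.MathematicalPhysics.QuantumLattice
open Literature.MathematicalPhysics.QuantumFieldTheory hiding SU2 su2Quat_mul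
open Literature.MathematicalPhysics.QuantumFieldTheory.Balaban1983to89
open Literature.MathematicalPhysics.QuantumFieldTheory.Balaban1983to89.T4HaarSU2ExpChart
open Summit.QuantumFields.YangMills.Theorems.FemtoTransferGap
open Summit.QuantumFields.YangMills.Theorems.FemtoTransferGap.TT
open Summit.QuantumFields.YangMills.Theorems.FemtoTransferGap.TwoLattice
open Summit.QuantumFields.YangMills.Theorems.FemtoTransferGap.TwoLattice.Flat
open Summit.QuantumFields.YangMills.Theorems.VirialFluxGap.AnchorSlice
open Summit.QuantumFields.YangMills.Theorems.VirialFluxGap.RingDeficit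
open Summit.QuantumFields.YangMills.Theorems.QuantitativeLaplace

namespace Summit.QuantumFields.YangMills.Theorems.VirialFluxGap.FixSplit

set_option maxHeartbeats 1600000 in
/-- ★★★★ **⟨stmt-QuantumFields-24204⟩ `SharpTwistedLaplace`** (see the module docstring). [cite: Luscher1983, §2] [cite: Breitung1994, Thm 41 p. 56]
[cite: Bredon1972, Ch. II §§4–5] -/
theorem sharpTwistedLaplace_holds : Summit.QuantumFields.YangMills.Theses.VirialFluxGap.SharpTwistedLaplace := by
  classical
  obtain ⟨ωC, ωN, ωX, C₀, N₀, hC, hN, hCN, hX, hC₀, hN₀, hNre, hCre, hNC⟩ := exists_anchor_frame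
  obtain ⟨r₀, D, G, A₀, cν, hr₀, hr₀1, hD, hG, hA₀, hcν, hpack⟩ := fix_htube_of_phasePackage'' hC hN hCN hX hC₀ hN₀
  obtain ⟨Kf, hKf, qf, hqf, L₀, hfloor0⟩ := ringDeficit_fix_floor_off_repTubes
  have hpiv : ∀ z : Fin 3 → Bool, ∃ k : Fin 3, z ≠ (fun _ => false) → z k = true := fun z => by
    by_cases hz : z = fun _ => false
    · exact ⟨0, fun h => (h hz).elim⟩
    · obtain ⟨k, hk⟩ := exists_pivot z hz
      exact ⟨k, fun _ => hk⟩
  choose k0 hk0 using hpiv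
  have hemb0 := fun z : Fin 3 → Bool => exists_signClass_embedding_surj (k0 z)
  choose emb hemb_inj hemb_k0 hemb_surj using hemb0
  have hlam0' : ∀ (L : ℕ) (z : Fin 3 → Bool), ∃ lam : Site 3 L → SU2, 2 ≤ L →
      (∀ x, lam x ∈ Subgroup.center SU2) ∧ lam 0 = 1 ∧
      (∀ (x : Site 3 L) (k : Fin 3), (x k = 0 ∨ x k = -1) → lam (x.shift k) = lam x * centreElem (z k)) ∧
      (∀ (x : Site 3 L) (k : Fin 3), x k ≠ 0 → x k ≠ -1 → lam (x.shift k) = lam x) := by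
    intro L z
    by_cases hL : 2 ≤ L
    · haveI : NeZero L := ⟨by omega⟩
      obtain ⟨lam, h1, h2, h3, h4⟩ := TwistEaterVolume.Quadratic.exists_twistSign hL z
      exact ⟨lam, fun _ => ⟨h1, h2, h3, h4⟩⟩
    · exact ⟨fun _ => 1, fun h => (hL h).elim⟩
  choose lam hlam using hlam0'
  obtain ⟨RbF, hRb1, hRb2, hRb3⟩ : ∃ RbF : ∀ (L : ℕ) [NeZero L] (hL : 2 ≤ L) (z s : Fin 3 → Bool), FixRest L ⟨(((fun _ => (-1 : ZMod L)), k0 z) : Edge 3 L), not_treeEdge_wrap hL (k0 z)⟩ 0,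
      (∀ (L : ℕ) [NeZero L] (hL : 2 ≤ L) (z s : Fin 3 → Bool) i, (RbF L hL z s).1 i = combFlat (fun a => centreElem (s a) * (if z a then N₀ else 1)) i.1.1) ∧
      (∀ (L : ℕ) [NeZero L] (hL : 2 ≤ L) (z s : Fin 3 → Bool) j e, (RbF L hL z s).2.1 j e = combFlat (fun a => centreElem (s a) * (if z a then N₀ else 1)) e) ∧
      (∀ (L : ℕ) [NeZero L] (hL : 2 ≤ L) (z s : Fin 3 → Bool) x, (RbF L hL z s).2.2 x = lam L z x.1 * C₀) :=
    ⟨fun L _ hL z s => ((fun i => combFlat (fun a => centreElem (s a) * (if z a then N₀ else 1)) i.1.1), ((fun j e => combFlat (fun a => centreElem (s a) * (if z a then N₀ else 1)) e), fun x => lam L z x.1 * C₀)),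
      fun _ _ _ _ _ _ => rfl, fun _ _ _ _ _ _ _ => rfl, fun _ _ _ _ _ _ => rfl⟩
  obtain ⟨cR, hcR⟩ : ∃ cR : ℝ, cR = min (1 / 10 ^ 30) (r₀ / 2) / (1 + D false + G false) := ⟨_, rfl⟩
  have hcR0 : 0 < cR := by
    rw [hcR]; exact div_pos (lt_min (by norm_num) (by linarith)) (by linarith [hD false, hG false])
  have hpack' : ∀ (L : ℕ) [NeZero L] (hL : 2 ≤ L) (z : Fin 3 → Bool) (hz : z ≠ fun _ => false) (t : Bool × Bool),
      ∃ A : EuclideanSpace ℝ (Fin (fixDim L ⟨(((fun _ => (-1 : ZMod L)), k0 z) : Edge 3 L), not_treeEdge_wrap hL (k0 z)⟩ 0)) →ₗ[ℝ] EuclideanSpace ℝ (Fin (fixDim L ⟨(((fun _ => (-1 : ZMod L)), k0 z) : Edge 3 L), not_treeEdge_wrap hL (k0 z)⟩ 0)),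
        A.IsSymmetric ∧ (∀ v, (2 / (10 ^ 22 * (L : ℝ) ^ 33)) * ‖v‖ ^ 2 ≤ ⟪A v, v⟫) ∧ (∀ v, ⟪A v, v⟫ ≤ 384 * (L : ℝ) ^ 4 * ‖v‖ ^ 2) ∧
        0 < (A₀ (emb z t (k0 z)) * (2 * Real.pi ^ 2)⁻¹ ^ Fintype.card ({i : OffIdx L // ¬ i = ⟨(((fun _ => (-1 : ZMod L)), k0 z) : Edge 3 L), not_treeEdge_wrap hL (k0 z)⟩} ⊕ ((Fin (2 * L - 1) × Edge 3 L) ⊕ {y : Site 3 L // ¬ y = (0 : Site 3 L)})) / cν (emb z t (k0 z)) / Real.sqrt (LinearMap.det (A))) ∧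
        ∀ (β R : ℝ), 0 < β → 0 < R → R ≤ r₀ → R ≤ 1 / (10 ^ 7 * (L : ℝ) ^ 11) →
          (288 * (L : ℝ) ^ 4 * Real.sqrt 2 ^ 3 + 26880 * (L : ℝ) ^ 4 * (1 / (10 ^ 7 * (L : ℝ) ^ 11))) * R + (26880 * (L : ℝ) ^ 4) * R ^ 2 ≤ (2 / (10 ^ 22 * (L : ℝ) ^ 33)) / (8 * (18 * (L : ℝ) ^ 4 + 8)) →
          D (emb z t (k0 z)) * R ≤ 1 → G (emb z t (k0 z)) * R ^ 2 ≤ 1 →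
          IntegrableOn (fun x : ((OffIdx L → SU2) × ((Fin (2 * L - 1) → GaugeConfig 3 L SU2) × (Site 3 L → SU2))) => Real.exp (-(β * ringDeficit L z ((Fin.cons (glue x.1) x.2.1 : Fin (2 * L - 1 + 1) → GaugeConfig 3 L SU2), x.2.2))))
            ((fun q : SU2 × EuclideanSpace ℝ (Fin (fixDim L ⟨(((fun _ => (-1 : ZMod L)), k0 z) : Edge 3 L), not_treeEdge_wrap hL (k0 z)⟩ 0)) => (((fun i => q.1 * (fixSlice ωC ωN ωX C₀ (centreElem (emb z t (k0 z)) * N₀) (RbF L hL z (emb z t)) (fixCoord q.2)).1 i * q.1⁻¹),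
            ((fun j => gaugeTransform (fun _ : Site 3 L => q.1) ((fixSlice ωC ωN ωX C₀ (centreElem (emb z t (k0 z)) * N₀) (RbF L hL z (emb z t)) (fixCoord q.2)).2.1 j)), (fun y => q.1 * (fixSlice ωC ωN ωX C₀ (centreElem (emb z t (k0 z)) * N₀) (RbF L hL z (emb z t)) (fixCoord q.2)).2.2 y * q.1⁻¹))) : ((OffIdx L → SU2) × ((Fin (2 * L - 1) → GaugeConfig 3 L SU2) × (Site 3 L → SU2))))) ''
          ((univ : Set SU2) ×ˢ closedBall (0 : EuclideanSpace ℝ (Fin (fixDim L ⟨(((fun _ => (-1 : ZMod L)), k0 z) : Edge 3 L), not_treeEdge_wrap hL (k0 z)⟩ 0))) (R)))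
            ((Measure.pi fun _ : OffIdx L => haarProbability SU2).prod
            ((Measure.pi fun _ : Fin (2 * L - 1) => configMeasure SU2 L).prod (gaugeMeasure L))) ∧
          |(∫ x, Real.exp (-(β * ringDeficit L z ((Fin.cons (glue x.1) x.2.1 : Fin (2 * L - 1 + 1) → GaugeConfig 3 L SU2), x.2.2)))
              ∂(((Measure.pi fun _ : OffIdx L => haarProbability SU2).prod
            ((Measure.pi fun _ : Fin (2 * L - 1) => configMeasure SU2 L).prod (gaugeMeasure L))).restrict
                ((fun q : SU2 × EuclideanSpace ℝ (Fin (fixDim L ⟨(((fun _ => (-1 : ZMod L)), k0 z) : Edge 3 L), not_treeEdge_wrap hL (k0 z)⟩ 0)) => (((fun i => q.1 * (fixSlice ωC ωN ωX C₀ (centreElem (emb z t (k0 z)) * N₀) (RbF L hL z (emb z t)) (fixCoord q.2)).1 i * q.1⁻¹),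
            ((fun j => gaugeTransform (fun _ : Site 3 L => q.1) ((fixSlice ωC ωN ωX C₀ (centreElem (emb z t (k0 z)) * N₀) (RbF L hL z (emb z t)) (fixCoord q.2)).2.1 j)), (fun y => q.1 * (fixSlice ωC ωN ωX C₀ (centreElem (emb z t (k0 z)) * N₀) (RbF L hL z (emb z t)) (fixCoord q.2)).2.2 y * q.1⁻¹))) : ((OffIdx L → SU2) × ((Fin (2 * L - 1) → GaugeConfig 3 L SU2) × (Site 3 L → SU2))))) ''
          ((univ : Set SU2) ×ˢ closedBall (0 : EuclideanSpace ℝ (Fin (fixDim L ⟨(((fun _ => (-1 : ZMod L)), k0 z) : Edge 3 L), not_treeEdge_wrap hL (k0 z)⟩ 0))) (R))))) -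
            (A₀ (emb z t (k0 z)) * (2 * Real.pi ^ 2)⁻¹ ^ Fintype.card ({i : OffIdx L // ¬ i = ⟨(((fun _ => (-1 : ZMod L)), k0 z) : Edge 3 L), not_treeEdge_wrap hL (k0 z)⟩} ⊕ ((Fin (2 * L - 1) × Edge 3 L) ⊕ {y : Site 3 L // ¬ y = (0 : Site 3 L)})) / cν (emb z t (k0 z)) / Real.sqrt (LinearMap.det (A))) * (2 * Real.pi / β) ^ ((9 : ℝ) * (L : ℝ) ^ 4)| ≤
            (16 * (18 * (L : ℝ) ^ 4 + 8) / ((2 / (10 ^ 22 * (L : ℝ) ^ 33)) * R ^ 2) + 16 * G (emb z t (k0 z)) * (18 * (L : ℝ) ^ 4 + 8) / (2 / (10 ^ 22 * (L : ℝ) ^ 33)) +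
            256 * ((26880 * (L : ℝ) ^ 4) + ((288 * (L : ℝ) ^ 4 * Real.sqrt 2 ^ 3 + 26880 * (L : ℝ) ^ 4 * (1 / (10 ^ 7 * (L : ℝ) ^ 11))) + (26880 * (L : ℝ) ^ 4) * R) * (D (emb z t (k0 z)) + G (emb z t (k0 z)) * R)) * (18 * (L : ℝ) ^ 4 + 8) ^ 2 / (2 / (10 ^ 22 * (L : ℝ) ^ 33)) ^ 2 + 18432 * ((288 * (L : ℝ) ^ 4 * Real.sqrt 2 ^ 3 + 26880 * (L : ℝ) ^ 4 * (1 / (10 ^ 7 * (L : ℝ) ^ 11))) + (26880 * (L : ℝ) ^ 4) * R) ^ 2 * (18 * (L : ℝ) ^ 4 + 8) ^ 3 / (2 / (10 ^ 22 * (L : ℝ) ^ 33)) ^ 3) / β *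
            ((A₀ (emb z t (k0 z)) * (2 * Real.pi ^ 2)⁻¹ ^ Fintype.card ({i : OffIdx L // ¬ i = ⟨(((fun _ => (-1 : ZMod L)), k0 z) : Edge 3 L), not_treeEdge_wrap hL (k0 z)⟩} ⊕ ((Fin (2 * L - 1) × Edge 3 L) ⊕ {y : Site 3 L // ¬ y = (0 : Site 3 L)})) / cν (emb z t (k0 z)) / Real.sqrt (LinearMap.det (A))) * (2 * Real.pi / β) ^ ((9 : ℝ) * (L : ℝ) ^ 4)) :=
    fun L _ hL z hz t => hpack L hL z hz (k0 z) (hk0 z hz) (lam L z) (hlam L z hL).1 (hlam L z hL).2.1 (hlam L z hL).2.2.1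
      (hlam L z hL).2.2.2 hNre hCre hNC (emb z t) (RbF L hL z (emb z t)) (hRb1 L hL z (emb z t)) (hRb2 L hL z (emb z t)) (hRb3 L hL z (emb z t))
  choose Aop hAs hAlo hAhi hApos hAtube using hpack'
  -- ### the data functions `T, c, K, η`
  obtain ⟨T, hT⟩ : ∃ T : (L : ℕ) → (Fin 3 → Bool) → Bool × Bool → Set ((OffIdx L → SU2) × ((Fin (2 * L - 1) → GaugeConfig 3 L SU2) × (Site 3 L → SU2))),
      ∀ (L : ℕ) [NeZero L] (hL : 2 ≤ L) (z : Fin 3 → Bool) (hz : z ≠ fun _ => false) (t : Bool × Bool),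
        T L z t = ((fun q : SU2 × EuclideanSpace ℝ (Fin (fixDim L ⟨(((fun _ => (-1 : ZMod L)), k0 z) : Edge 3 L), not_treeEdge_wrap hL (k0 z)⟩ 0)) =>
          (((fun i => q.1 * (fixSlice ωC ωN ωX C₀ (centreElem (emb z t (k0 z)) * N₀) (RbF L hL z (emb z t)) (fixCoord q.2)).1 i * q.1⁻¹),
            ((fun j => gaugeTransform (fun _ : Site 3 L => q.1) ((fixSlice ωC ωN ωX C₀ (centreElem (emb z t (k0 z)) * N₀) (RbF L hL z (emb z t)) (fixCoord q.2)).2.1 j)),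
              (fun y => q.1 * (fixSlice ωC ωN ωX C₀ (centreElem (emb z t (k0 z)) * N₀) (RbF L hL z (emb z t)) (fixCoord q.2)).2.2 y * q.1⁻¹))) : ((OffIdx L → SU2) × ((Fin (2 * L - 1) → GaugeConfig 3 L SU2) × (Site 3 L → SU2))))) ''
          ((univ : Set SU2) ×ˢ closedBall (0 : EuclideanSpace ℝ (Fin (fixDim L ⟨(((fun _ => (-1 : ZMod L)), k0 z) : Edge 3 L), not_treeEdge_wrap hL (k0 z)⟩ 0))) ((cR / (L : ℝ) ^ 41)))) := by
    refine ⟨fun L z t => if h : 2 ≤ L ∧ z ≠ (fun _ => false) then ?_ else ∅, ?_⟩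
    · haveI : NeZero L := ⟨by omega⟩
      exact ((fun q : SU2 × EuclideanSpace ℝ (Fin (fixDim L ⟨(((fun _ => (-1 : ZMod L)), k0 z) : Edge 3 L), not_treeEdge_wrap h.1 (k0 z)⟩ 0)) =>
          (((fun i => q.1 * (fixSlice ωC ωN ωX C₀ (centreElem (emb z t (k0 z)) * N₀) (RbF L h.1 z (emb z t)) (fixCoord q.2)).1 i * q.1⁻¹),
            ((fun j => gaugeTransform (fun _ : Site 3 L => q.1) ((fixSlice ωC ωN ωX C₀ (centreElem (emb z t (k0 z)) * N₀) (RbF L h.1 z (emb z t)) (fixCoord q.2)).2.1 j)),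
              (fun y => q.1 * (fixSlice ωC ωN ωX C₀ (centreElem (emb z t (k0 z)) * N₀) (RbF L h.1 z (emb z t)) (fixCoord q.2)).2.2 y * q.1⁻¹))) : ((OffIdx L → SU2) × ((Fin (2 * L - 1) → GaugeConfig 3 L SU2) × (Site 3 L → SU2))))) ''
          ((univ : Set SU2) ×ˢ closedBall (0 : EuclideanSpace ℝ (Fin (fixDim L ⟨(((fun _ => (-1 : ZMod L)), k0 z) : Edge 3 L), not_treeEdge_wrap h.1 (k0 z)⟩ 0))) ((cR / (L : ℝ) ^ 41))))
    · intro L _ hL z hz t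
      beta_reduce
      rw [dif_pos (And.intro hL hz)]
  obtain ⟨c, hc⟩ : ∃ c : ℕ → (Fin 3 → Bool) → Bool × Bool → ℝ,
      ∀ (L : ℕ) [NeZero L] (hL : 2 ≤ L) (z : Fin 3 → Bool) (hz : z ≠ fun _ => false) (t : Bool × Bool),
        c L z t = (A₀ (emb z t (k0 z)) * (2 * Real.pi ^ 2)⁻¹ ^ Fintype.card ({i : OffIdx L // ¬ i = ⟨(((fun _ => (-1 : ZMod L)), k0 z) : Edge 3 L), not_treeEdge_wrap hL (k0 z)⟩} ⊕ ((Fin (2 * L - 1) × Edge 3 L) ⊕ {y : Site 3 L // ¬ y = (0 : Site 3 L)})) / cν (emb z t (k0 z)) / Real.sqrt (LinearMap.det (Aop L hL z hz t))) := by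
    refine ⟨fun L z t => if h : 2 ≤ L ∧ z ≠ (fun _ => false) then ?_ else 1, ?_⟩
    · haveI : NeZero L := ⟨by omega⟩
      exact (A₀ (emb z t (k0 z)) * (2 * Real.pi ^ 2)⁻¹ ^ Fintype.card ({i : OffIdx L // ¬ i = ⟨(((fun _ => (-1 : ZMod L)), k0 z) : Edge 3 L), not_treeEdge_wrap h.1 (k0 z)⟩} ⊕ ((Fin (2 * L - 1) × Edge 3 L) ⊕ {y : Site 3 L // ¬ y = (0 : Site 3 L)})) / cν (emb z t (k0 z)) / Real.sqrt (LinearMap.det (Aop L h.1 z h.2 t)))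
    · intro L _ hL z hz t
      beta_reduce
      rw [dif_pos (And.intro hL hz)]
  obtain ⟨K, hK⟩ : ∃ K : ℕ → (Fin 3 → Bool) → Bool × Bool → ℝ, ∀ (L : ℕ) (z : Fin 3 → Bool) (t : Bool × Bool),
      K L z t = (16 * (18 * (L : ℝ) ^ 4 + 8) / ((2 / (10 ^ 22 * (L : ℝ) ^ 33)) * (cR / (L : ℝ) ^ 41) ^ 2) +
              16 * G (emb z t (k0 z)) * (18 * (L : ℝ) ^ 4 + 8) / (2 / (10 ^ 22 * (L : ℝ) ^ 33)) +
            256 * ((26880 * (L : ℝ) ^ 4) + ((288 * (L : ℝ) ^ 4 * Real.sqrt 2 ^ 3 + 26880 * (L : ℝ) ^ 4 * (1 / (10 ^ 7 * (L : ℝ) ^ 11))) + (26880 * (L : ℝ) ^ 4) * (cR / (L : ℝ) ^ 41)) * (D (emb z t (k0 z)) + G (emb z t (k0 z)) * (cR / (L : ℝ) ^ 41))) * (18 * (L : ℝ) ^ 4 + 8) ^ 2 / (2 / (10 ^ 22 * (L : ℝ) ^ 33)) ^ 2 +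
            18432 * ((288 * (L : ℝ) ^ 4 * Real.sqrt 2 ^ 3 + 26880 * (L : ℝ) ^ 4 * (1 / (10 ^ 7 * (L : ℝ) ^ 11))) + (26880 * (L : ℝ) ^ 4) * (cR / (L : ℝ) ^ 41)) ^ 2 * (18 * (L : ℝ) ^ 4 + 8) ^ 3 / (2 / (10 ^ 22 * (L : ℝ) ^ 33)) ^ 3) := ⟨fun L z t => _, fun _ _ _ => rfl⟩
  obtain ⟨η, hη⟩ : ∃ η : ℕ → (Fin 3 → Bool) → ℝ, ∀ (L : ℕ) (z : Fin 3 → Bool),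
      η L z = min (Kf * (L : ℝ) ^ qf)⁻¹ (((cR / (L : ℝ) ^ 41) ^ 2 / (200000 * (L : ℝ) ^ 4)) / (1010 * (L : ℝ) ^ 6 * (Kf * (L : ℝ) ^ qf))) :=
    ⟨fun L z => _, fun _ _ => rfl⟩
  obtain ⟨qn, hqn⟩ : ∃ qn : ℕ, qf ≤ qn := ⟨⌈qf⌉₊, Nat.le_ceil qf⟩
  set AP : ℝ := 5 * 10 ^ 21 + 1 / cR + 27744 + 26880 + D false + G false + 1 with hAP
  set AΛ : ℝ := |Real.log (A₀ false)| + |Real.log (cν false)| + 5 * 10 ^ 22 with hAΛ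
  set Aη : ℝ := Kf * (1 + 202000000 / cR ^ 2) with hAη
  set A : ℝ := 2 * 10 ^ 9 * AP ^ 5 + AΛ + Aη with hAdef
  have hAP1 : 1 ≤ AP := by
    have := hD false; have := hG false; have : 0 < 1 / cR := by positivity
    rw [hAP]; linarith
  have hAΛ0 : 0 ≤ AΛ := by rw [hAΛ]; positivity
  have hAη0 : 0 ≤ Aη := by rw [hAη]; positivity
  have hA1 : 1 ≤ A := by
    have : 1 ≤ AP ^ 5 := one_le_pow₀ hAP1
    rw [hAdef]; nlinarith
  set p : ℕ := 217 + (92 + qn) with hp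
  set L₁ : ℕ := max L₀ 2 with hL₁
  have hmono : ∀ (L : ℕ), 2 ≤ L → ∀ (B : ℝ) (m : ℕ), 0 ≤ B → B ≤ A → m ≤ p → B * (L : ℝ) ^ m ≤ A * (L : ℝ) ^ p := by
    intro L hL B m hB hBA hm
    have hL1 : (1 : ℝ) ≤ L := by exact_mod_cast (by omega : 1 ≤ L)
    exact mul_le_mul hBA (pow_le_pow_right₀ hL1 hm) (by positivity) (by linarith)
  have hwin : ∀ (L : ℕ), 2 ≤ L →
      0 < (cR / (L : ℝ) ^ 41) ∧ (cR / (L : ℝ) ^ 41) < 1 ∧ (cR / (L : ℝ) ^ 41) ≤ r₀ ∧ (cR / (L : ℝ) ^ 41) ≤ 1 / (10 ^ 7 * (L : ℝ) ^ 11) ∧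
      (288 * (L : ℝ) ^ 4 * Real.sqrt 2 ^ 3 + 26880 * (L : ℝ) ^ 4 * (1 / (10 ^ 7 * (L : ℝ) ^ 11))) * (cR / (L : ℝ) ^ 41) + (26880 * (L : ℝ) ^ 4) * (cR / (L : ℝ) ^ 41) ^ 2 ≤ (2 / (10 ^ 22 * (L : ℝ) ^ 33)) / (8 * (18 * (L : ℝ) ^ 4 + 8)) ∧
      D false * (cR / (L : ℝ) ^ 41) ≤ 1 ∧ G false * (cR / (L : ℝ) ^ 41) ^ 2 ≤ 1 := by
    intro L hL
    have hL1 : (1 : ℝ) ≤ L := by exact_mod_cast (by omega : 1 ≤ L)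
    have h := window_choice hr₀ (hD false) (hG false) hL1
    rw [← hcR] at h
    exact h
  have hc' : ∀ (L : ℕ) (z : Fin 3 → Bool) (t : Bool × Bool), L₁ ≤ L → z ≠ (fun _ => false) → 0 < c L z t := by
    intro L z t hL₁ hz
    have hL : 2 ≤ L := le_trans (le_max_right _ _) hL₁
    haveI : NeZero L := ⟨by omega⟩
    rw [hc L hL z hz t]
    exact hApos L hL z hz t
  have hTm' : ∀ (L : ℕ) (z : Fin 3 → Bool) (t : Bool × Bool), L₁ ≤ L → z ≠ (fun _ => false) → MeasurableSet (T L z t) := by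
    intro L z t hL₁ hz
    have hL : 2 ≤ L := le_trans (le_max_right _ _) hL₁
    haveI : NeZero L := ⟨by omega⟩
    rw [hT L hL z hz t]
    exact fix_hT ωC ωN ωX C₀ (centreElem (emb z t (k0 z)) * N₀) (RbF L hL z (emb z t)) (cR / (L : ℝ) ^ 41)
  have hdisj' : ∀ (L : ℕ) (z : Fin 3 → Bool), L₁ ≤ L → z ≠ (fun _ => false) → Pairwise fun a b => Disjoint (T L z a) (T L z b) := by
    intro L z hL₁ hz t t' htt'
    have hL : 2 ≤ L := le_trans (le_max_right _ _) hL₁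
    haveI : NeZero L := ⟨by omega⟩
    rw [hT L hL z hz t, hT L hL z hz t']
    exact fixTubes_disjoint hL z (hk0 z hz) (hlam L z hL).2.1 hC hN hX (RbF L hL z) (hRb1 L hL z) (hRb2 L hL z) (hRb3 L hL z)
      (fun h => htt' (hemb_inj z h)) (by rw [hemb_k0, hemb_k0]) (hwin L hL).2.1
  have htube' : ∀ (β : ℝ) (L : ℕ) [NeZero L] (z : Fin 3 → Bool) (t : Bool × Bool), 1 ≤ β → L₁ ≤ L → z ≠ (fun _ => false) →
      |(∫ x in T L z t, Real.exp (-(β * ringDeficit L z ((Fin.cons (glue x.1) x.2.1 : Fin (2 * L - 1 + 1) → GaugeConfig 3 L SU2), x.2.2)))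
          ∂((Measure.pi fun _ : OffIdx L => haarProbability SU2).prod
            ((Measure.pi fun _ : Fin (2 * L - 1) => configMeasure SU2 L).prod (gaugeMeasure L)))) -
        c L z t * (2 * Real.pi / β) ^ ((9 : ℝ) * (L : ℝ) ^ 4)| ≤ K L z t / β * (c L z t * (2 * Real.pi / β) ^ ((9 : ℝ) * (L : ℝ) ^ 4)) := by
    intro β L _ z t hβ hL₁ hz
    have hL : 2 ≤ L := le_trans (le_max_right _ _) hL₁
    obtain ⟨hR0, hR1, hRr, hRw, hsmall, hDR, hGR⟩ := hwin L hL
    have hDR' : D (emb z t (k0 z)) * (cR / (L : ℝ) ^ 41) ≤ 1 := by rw [hemb_k0]; exact hDR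
    have hGR' : G (emb z t (k0 z)) * (cR / (L : ℝ) ^ 41) ^ 2 ≤ 1 := by rw [hemb_k0]; exact hGR
    obtain ⟨-, hest⟩ := hAtube L hL z hz t β (cR / (L : ℝ) ^ 41) (by linarith) hR0 hRr hRw hsmall hDR' hGR'
    rw [hT L hL z hz t, hc L hL z hz t, hK L z t]
    exact hest
  have hfloor' : ∀ (L : ℕ) [NeZero L] (z : Fin 3 → Bool), L₁ ≤ L → z ≠ (fun _ => false) →
      ∀ x : ((OffIdx L → SU2) × ((Fin (2 * L - 1) → GaugeConfig 3 L SU2) × (Site 3 L → SU2))), x ∉ (⋃ a, T L z a) → η L z ≤ ringDeficit L z ((Fin.cons (glue x.1) x.2.1 : Fin (2 * L - 1 + 1) → GaugeConfig 3 L SU2), x.2.2) := by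
    intro L _ z hL₁ hz x hx
    have hL : 2 ≤ L := le_trans (le_max_right _ _) hL₁
    have hL₀ : L₀ ≤ L := le_trans (le_max_left _ _) hL₁
    obtain ⟨hR0, hR1, -, -, -, -, -⟩ := hwin L hL
    have hρ0 : 0 < (cR / (L : ℝ) ^ 41) ^ 2 / (200000 * (L : ℝ) ^ 4) := by positivity
    have hρ : (cR / (L : ℝ) ^ 41) ^ 2 / (200000 * (L : ℝ) ^ 4) ≤ 1 / 1600 := by
      have hL1 : (1 : ℝ) ≤ L := by exact_mod_cast (by omega : 1 ≤ L)
      have h4 : 1 ≤ (L : ℝ) ^ 4 := one_le_pow₀ hL1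
      have hsq : (cR / (L : ℝ) ^ 41) ^ 2 ≤ 1 := by nlinarith
      calc (cR / (L : ℝ) ^ 41) ^ 2 / (200000 * (L : ℝ) ^ 4) ≤ 1 / (200000 * (L : ℝ) ^ 4) :=
            div_le_div_of_nonneg_right hsq (by positivity)
        _ ≤ 1 / 1600 := one_div_le_one_div_of_le (by norm_num) (by nlinarith)
    have hRV : 200000 * (L : ℝ) ^ 4 * ((cR / (L : ℝ) ^ 41) ^ 2 / (200000 * (L : ℝ) ^ 4)) ≤ (cR / (L : ℝ) ^ 41) ^ 2 := by
      rw [mul_div_cancel₀ _ (by positivity)]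
    refine le_trans (le_of_eq (hη L z)) ?_
    refine hfloor0 L hL₀ hL z hz (hk0 z hz) (hlam L z hL).1 (hlam L z hL).2.1 (hlam L z hL).2.2.1 (hlam L z hL).2.2.2
      hNre hCre hNC hC hN hCN hX hC₀ hN₀ (RbF L hL z) (hRb1 L hL z) (hRb2 L hL z) (hRb3 L hL z) hρ0 hρ hR0.le hRV x ?_
    intro s hs hxs
    obtain ⟨t, rfl⟩ := hemb_surj z s hs
    exact hx (Set.mem_iUnion.2 ⟨t, by rw [hT L hL z hz t]; exact hxs⟩)
  have hK' : ∀ (L : ℕ) (z : Fin 3 → Bool) (t : Bool × Bool), L₁ ≤ L → z ≠ (fun _ => false) → K L z t ≤ A * (L : ℝ) ^ p := by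
    intro L z t hL₁ hz
    have hL : 2 ≤ L := le_trans (le_max_right _ _) hL₁
    have hL1 : (1 : ℝ) ≤ L := by exact_mod_cast (by omega : 1 ≤ L)
    obtain ⟨hR0, hR1, -, -, -, -, -⟩ := hwin L hL
    rw [hK L z t, hemb_k0 z t]
    have hL4 : 1 ≤ (L : ℝ) ^ 4 := one_le_pow₀ hL1
    have hL41 : 1 ≤ (L : ℝ) ^ 41 := one_le_pow₀ hL1
    have hDf := hD false
    have hGf := hG false
    have hcRi : 0 < 1 / cR := by positivity
    have hAP5 : 5 * 10 ^ 21 ≤ AP := by rw [hAP]; linarith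
    have hAPc : 1 / cR ≤ AP := by rw [hAP]; linarith
    have hAP3 : (27744 : ℝ) ≤ AP := by rw [hAP]; linarith
    have hAPD : D false ≤ AP := by rw [hAP]; linarith
    have hAPG : G false ≤ AP := by rw [hAP]; linarith
    have hAP0 : 0 ≤ AP := by linarith
    have hP41 : ∀ B : ℝ, 0 ≤ B → B ≤ AP → B ≤ AP * (L : ℝ) ^ 41 := fun B hB hBA =>
      hBA.trans (le_mul_of_one_le_right hAP0 hL41)
    have hlamP : 1 / (2 / (10 ^ 22 * (L : ℝ) ^ 33)) ≤ AP * (L : ℝ) ^ 41 := by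
      rw [one_div_div]
      calc 10 ^ 22 * (L : ℝ) ^ 33 / 2 = 5 * 10 ^ 21 * (L : ℝ) ^ 33 := by ring
        _ ≤ AP * (L : ℝ) ^ 41 := mul_le_mul hAP5 (pow_le_pow_right₀ hL1 (by norm_num)) (by positivity) hAP0
    have hRP : 1 / (cR / (L : ℝ) ^ 41) ≤ AP * (L : ℝ) ^ 41 := by
      rw [one_div_div, div_eq_mul_one_div, mul_comm]
      exact mul_le_mul_of_nonneg_right hAPc (by positivity)
    have hA₃P : (288 * (L : ℝ) ^ 4 * Real.sqrt 2 ^ 3 + 26880 * (L : ℝ) ^ 4 * (1 / (10 ^ 7 * (L : ℝ) ^ 11))) ≤ AP * (L : ℝ) ^ 41 :=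
      (phaseA₃_le hL1).trans (mul_le_mul hAP3 (pow_le_pow_right₀ hL1 (by norm_num)) (by positivity) hAP0)
    have hA₄P : (26880 * (L : ℝ) ^ 4) ≤ AP * (L : ℝ) ^ 41 :=
      mul_le_mul (by linarith) (pow_le_pow_right₀ hL1 (by norm_num)) (by positivity) hAP0
    have hbound := orbitConst_le_poly_pow (n := 18 * (L : ℝ) ^ 4) (p := 41) hL1 hAP1 (by positivity) (by nlinarith) (by positivity) hlamP
      hR0 hR1.le hRP (by positivity) hA₃P (by positivity) hA₄P (hD false) (hP41 _ (hD false) hAPD) (hG false) (hP41 _ (hG false) hAPG)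
    refine hbound.trans (hmono L hL _ _ (by positivity) ?_ (by omega))
    rw [hAdef]; linarith
  have hΛ' : ∀ (L : ℕ) (z : Fin 3 → Bool), L₁ ≤ L → z ≠ (fun _ => false) → |Real.log (∑ t, c L z t)| ≤ A * (L : ℝ) ^ p := by
    intro L z hL₁ hz
    have hL : 2 ≤ L := le_trans (le_max_right _ _) hL₁
    haveI : NeZero L := ⟨by omega⟩
    have hL1 : (1 : ℝ) ≤ L := by exact_mod_cast (by omega : 1 ≤ L)
    have hL0 : (0 : ℝ) < L := by linarith
    have hlampos : 0 < (2 / (10 ^ 22 * (L : ℝ) ^ 33)) := by positivity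
    have hc₀ : 0 < (2 * Real.pi ^ 2)⁻¹ := by positivity
    have hN : (Fintype.card ({i : OffIdx L // ¬ i = ⟨(((fun _ => (-1 : ZMod L)), k0 z) : Edge 3 L), not_treeEdge_wrap hL (k0 z)⟩} ⊕ ((Fin (2 * L - 1) × Edge 3 L) ⊕ {y : Site 3 L // ¬ y = (0 : Site 3 L)})) : ℝ) ≤ 10 * (L : ℝ) ^ 4 := by
      have h1 : Fintype.card {i : OffIdx L // ¬ i = ⟨(((fun _ => (-1 : ZMod L)), k0 z) : Edge 3 L), not_treeEdge_wrap hL (k0 z)⟩} ≤ 2 * L ^ 3 + 1 :=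
        (Fintype.card_subtype_le _).trans (card_offIdx (L := L)).le
      have h2 : Fintype.card (Fin (2 * L - 1) × Edge 3 L) ≤ 6 * L ^ 4 := by
        rw [Fintype.card_prod, Fintype.card_fin, FemtoTransferGap.card_edge_three]
        have : 2 * L - 1 ≤ 2 * L := Nat.sub_le _ _
        calc (2 * L - 1) * (3 * L ^ 3) ≤ (2 * L) * (3 * L ^ 3) := Nat.mul_le_mul_right _ this
          _ = 6 * L ^ 4 := by ring
      have h3 : Fintype.card {y : Site 3 L // ¬ y = (0 : Site 3 L)} ≤ L ^ 3 :=
        (Fintype.card_subtype_le _).trans (Literature.MathematicalPhysics.QuantumFieldTheory.card_site_three L).le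
      have h4 : Fintype.card ({i : OffIdx L // ¬ i = ⟨(((fun _ => (-1 : ZMod L)), k0 z) : Edge 3 L), not_treeEdge_wrap hL (k0 z)⟩} ⊕ ((Fin (2 * L - 1) × Edge 3 L) ⊕ {y : Site 3 L // ¬ y = (0 : Site 3 L)})) ≤ 10 * L ^ 4 := by
        rw [Fintype.card_sum, Fintype.card_sum]
        have hL3 : L ^ 3 ≤ L ^ 4 := Nat.pow_le_pow_right (by omega) (by norm_num)
        have hL4 : 1 ≤ L ^ 4 := Nat.one_le_pow _ _ (by omega)
        omega
      exact_mod_cast h4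
    have hmax : max |Real.log (2 / (10 ^ 22 * (L : ℝ) ^ 33))| |Real.log (384 * (L : ℝ) ^ 4)| ≤ 5 * 10 ^ 21 * (L : ℝ) ^ 33 := by
      refine max_le ?_ ?_
      · have hle1 : (2 / (10 ^ 22 * (L : ℝ) ^ 33)) ≤ 1 := by
          rw [div_le_one (by positivity)]
          have : (1 : ℝ) ≤ (L : ℝ) ^ 33 := one_le_pow₀ hL1
          nlinarith
        rw [abs_of_nonpos (Real.log_nonpos hlampos.le hle1), ← Real.log_inv]
        have hinv : ((2 / (10 ^ 22 * (L : ℝ) ^ 33)))⁻¹ = 5 * 10 ^ 21 * (L : ℝ) ^ 33 := by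
          rw [inv_div]; ring
        rw [hinv]
        have hpos : 0 < 5 * 10 ^ 21 * (L : ℝ) ^ 33 := by positivity
        linarith [Real.log_le_sub_one_of_pos hpos]
      · have hge1 : (1 : ℝ) ≤ 384 * (L : ℝ) ^ 4 := by
          have : (1 : ℝ) ≤ (L : ℝ) ^ 4 := one_le_pow₀ hL1
          nlinarith
        rw [abs_of_nonneg (Real.log_nonneg hge1)]
        have hpos : 0 < 384 * (L : ℝ) ^ 4 := by positivity
        have h33 : (L : ℝ) ^ 4 ≤ (L : ℝ) ^ 33 := pow_le_pow_right₀ hL1 (by norm_num)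
        linarith [Real.log_le_sub_one_of_pos hpos]
    have hlogc₀ : |Real.log (2 * Real.pi ^ 2)⁻¹| ≤ 40 := by
      have hge1 : (1 : ℝ) ≤ 2 * Real.pi ^ 2 := by nlinarith [Real.pi_gt_three]
      rw [Real.log_inv, abs_neg, abs_of_nonneg (Real.log_nonneg hge1)]
      have hpos : 0 < 2 * Real.pi ^ 2 := by positivity
      have hπ2 : Real.pi ^ 2 < 16 := by nlinarith [Real.pi_pos, Real.pi_lt_four]
      linarith [Real.log_le_sub_one_of_pos hpos, hπ2]
    have hfin : (finrank ℝ (EuclideanSpace ℝ (Fin (fixDim L ⟨(((fun _ => (-1 : ZMod L)), k0 z) : Edge 3 L), not_treeEdge_wrap hL (k0 z)⟩ 0))) : ℝ) = 18 * (L : ℝ) ^ 4 := by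
      rw [finrank_fixModel]; push_cast; ring
    have hct : ∀ t : Bool × Bool, |Real.log (c L z t)| ≤ AΛ * (L : ℝ) ^ 37 - 3 := by
      intro t
      rw [hc L hL z hz t, hemb_k0 z t]
      have h := abs_log_orbitCoeff_le (hAs L hL z hz t) hlampos (hAlo L hL z hz t) (hAhi L hL z hz t) (hA₀ false) hc₀ (hcν false)
        (Fintype.card ({i : OffIdx L // ¬ i = ⟨(((fun _ => (-1 : ZMod L)), k0 z) : Edge 3 L), not_treeEdge_wrap hL (k0 z)⟩} ⊕ ((Fin (2 * L - 1) × Edge 3 L) ⊕ {y : Site 3 L // ¬ y = (0 : Site 3 L)})))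
      rw [hfin] at h
      refine h.trans ?_
      have e1 : (Fintype.card ({i : OffIdx L // ¬ i = ⟨(((fun _ => (-1 : ZMod L)), k0 z) : Edge 3 L), not_treeEdge_wrap hL (k0 z)⟩} ⊕ ((Fin (2 * L - 1) × Edge 3 L) ⊕ {y : Site 3 L // ¬ y = (0 : Site 3 L)})) : ℝ) * |Real.log (2 * Real.pi ^ 2)⁻¹| ≤ 10 * (L : ℝ) ^ 4 * 40 :=
        mul_le_mul hN hlogc₀ (abs_nonneg _) (by positivity)
      have e2 : 18 * (L : ℝ) ^ 4 / 2 * max |Real.log (2 / (10 ^ 22 * (L : ℝ) ^ 33))| |Real.log (384 * (L : ℝ) ^ 4)| ≤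
          18 * (L : ℝ) ^ 4 / 2 * (5 * 10 ^ 21 * (L : ℝ) ^ 33) := mul_le_mul_of_nonneg_left hmax (by positivity)
      have hL37a : (L : ℝ) ^ 4 ≤ (L : ℝ) ^ 37 := pow_le_pow_right₀ hL1 (by norm_num)
      have hL37b : (L : ℝ) ^ 4 * (L : ℝ) ^ 33 = (L : ℝ) ^ 37 := by rw [← pow_add]
      have hL37c : (1 : ℝ) ≤ (L : ℝ) ^ 37 := one_le_pow₀ hL1
      have hA0 : 0 ≤ |Real.log (A₀ false)| := abs_nonneg _
      have hcν0 : 0 ≤ |Real.log (cν false)| := abs_nonneg _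
      rw [hAΛ]
      nlinarith
    have hsum := abs_log_sum_le (ι := Bool × Bool) (c := fun t => c L z t) (B := AΛ * (L : ℝ) ^ 37 - 3)
      (fun t => hc' L z t hL₁ hz) hct
    have hcard : Real.log (Fintype.card (Bool × Bool) : ℝ) ≤ 3 := by
      have h4 : (Fintype.card (Bool × Bool) : ℝ) = 4 := by norm_num [Fintype.card_prod, Fintype.card_bool]
      rw [h4]
      have := Real.log_le_sub_one_of_pos (by norm_num : (0 : ℝ) < 4)
      linarith
    refine hsum.trans ?_
    have hAΛA : AΛ ≤ A := by
      have : 0 ≤ 2 * 10 ^ 9 * AP ^ 5 := by positivity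
      rw [hAdef]; linarith
    have hm := hmono L hL AΛ 37 hAΛ0 hAΛA (by omega)
    linarith
  have hη' : ∀ (L : ℕ) (z : Fin 3 → Bool), L₁ ≤ L → z ≠ (fun _ => false) → 1 / (A * (L : ℝ) ^ p) ≤ η L z := by
    intro L z hL₁ hz
    have hL : 2 ≤ L := le_trans (le_max_right _ _) hL₁
    have hL1 : (1 : ℝ) ≤ L := by exact_mod_cast (by omega : 1 ≤ L)
    have hL0 : (0 : ℝ) < L := by linarith
    have hq : (L : ℝ) ^ qf ≤ (L : ℝ) ^ qn := by
      have h := Real.rpow_le_rpow_of_exponent_le hL1 hqn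
      rwa [Real.rpow_natCast] at h
    have hAη_le : Aη ≤ A := by
      have : 0 ≤ 2 * 10 ^ 9 * AP ^ 5 := by positivity
      rw [hAdef]; linarith
    have hKfA : Kf ≤ Aη := by
      rw [hAη]
      have : 0 ≤ 202000000 / cR ^ 2 := by positivity
      nlinarith
    rw [hη L z]
    refine le_min ?_ ?_
    · rw [← one_div]
      refine one_div_le_one_div_of_le (by positivity) ?_
      calc Kf * (L : ℝ) ^ qf ≤ Kf * (L : ℝ) ^ qn := mul_le_mul_of_nonneg_left hq hKf.le
        _ ≤ A * (L : ℝ) ^ p := hmono L hL Kf qn hKf.le (hKfA.trans hAη_le) (by omega)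
    · rw [div_le_div_iff₀ (by positivity) (by positivity), one_mul]
      have hρ_eq : (cR / (L : ℝ) ^ 41) ^ 2 / (200000 * (L : ℝ) ^ 4) = cR ^ 2 / (200000 * (L : ℝ) ^ 86) := by
        rw [div_pow, ← pow_mul, div_div]
        congr 1
        ring
      rw [hρ_eq]
      have hpow : (L : ℝ) ^ 6 * (L : ℝ) ^ qn * (L : ℝ) ^ 86 ≤ (L : ℝ) ^ p := by
        rw [← pow_add, ← pow_add]
        exact pow_le_pow_right₀ hL1 (by omega)
      have s1 : 1010 * (L : ℝ) ^ 6 * (Kf * (L : ℝ) ^ qf) ≤ 1010 * (L : ℝ) ^ 6 * (Kf * (L : ℝ) ^ qn) :=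
        mul_le_mul_of_nonneg_left (mul_le_mul_of_nonneg_left hq hKf.le) (by positivity)
      have s2 : cR ^ 2 / (200000 * (L : ℝ) ^ 86) * (Aη * (L : ℝ) ^ p) ≤ cR ^ 2 / (200000 * (L : ℝ) ^ 86) * (A * (L : ℝ) ^ p) :=
        mul_le_mul_of_nonneg_left (mul_le_mul_of_nonneg_right hAη_le (by positivity)) (by positivity)
      have s3 : 1010 * (L : ℝ) ^ 6 * (Kf * (L : ℝ) ^ qn) ≤ cR ^ 2 / (200000 * (L : ℝ) ^ 86) * (Aη * (L : ℝ) ^ p) := by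
        rw [div_mul_eq_mul_div, le_div_iff₀ (by positivity), hAη]
        have e : cR ^ 2 * (Kf * (1 + 202000000 / cR ^ 2) * (L : ℝ) ^ p) = Kf * (cR ^ 2 + 202000000) * (L : ℝ) ^ p := by
          field_simp
        rw [e]
        have h1 : 1010 * (L : ℝ) ^ 6 * (Kf * (L : ℝ) ^ qn) * (200000 * (L : ℝ) ^ 86) =
            202000000 * Kf * ((L : ℝ) ^ 6 * (L : ℝ) ^ qn * (L : ℝ) ^ 86) := by ring
        rw [h1]
        have h2 : 202000000 * Kf * ((L : ℝ) ^ 6 * (L : ℝ) ^ qn * (L : ℝ) ^ 86) ≤ 202000000 * Kf * (L : ℝ) ^ p :=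
          mul_le_mul_of_nonneg_left hpow (by positivity)
        have h3 : 202000000 * Kf * (L : ℝ) ^ p ≤ Kf * (cR ^ 2 + 202000000) * (L : ℝ) ^ p := by
          have : 0 ≤ Kf * cR ^ 2 * (L : ℝ) ^ p := by positivity
          nlinarith
        linarith
      linarith
  have final := sharpTwistedLaplace_of_fixTubes (ι := Bool × Bool) hA1 hc' hK' hΛ' hη' T hTm' hdisj' htube' hfloor'
  exact final

end Summit.QuantumFields.YangMills.Theorems.VirialFluxGap.FixSplit

end
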